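import Summits.Schanuel.Schanuel.Theorems.DiophantineDichotomyKhovanskiiApproxTypeEvExpAlgClauseMeasure
import Summits.Schanuel.Schanuel.Theorems.KhovanskiiApproxType.Negative.LoadBearing
import Literature.NumberTheory.Transcendental.ExpOneTranscendenceMeasureProofs
import HarnessLib

/-!
# A synchronised Diaz slot (`stub_syncDiazSlot`) — crux `DiophantineDichotomy.KhovanskiiApproxTypeEv`
# (stmt-Schanuel-14972), line `Sketch`, skeleton v14, sub-goal H

Line `Sketch` of crux `DiophantineDichotomy.KhovanskiiApproxTypeEv` (stmt-Schanuel-14972), skeleton v14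
(lead `prover-line-stmt-Schanuel-14972-c14-0`), registered stub `stub_syncDiazSlot` (sub-goal H) — `--supports`.

For algebraic `β ≠ 0` there is `q > 0` such that for every degree budget `m ≥ 50`, at EVERY sufficiently
large scale `M` (not just infinitely often), some algebraic `α` with an irreducible integer clause `P` of degree
`1 ≤ deg P ≤ m` and Mahler measure `M(P) ≤ M` satisfies `|e^β − α| ≤ exp(−q · m · log M)`.  The lead runs `n`
such slots at a common scale (sub-goal I, the Dirichlet floor `a ≥ 1/n` at every Lindemann–Weierstrass point).

Proof.  Two PROVED tree theorems combine:
* Diaz's theorem `Literature.NumberTheory.DiophantineApproximation.Bugeaud2004_thm_8_11_holds` (Bugeaud 2004,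
  Thm 8.11) at `ξ = e^β`, degree `m`, scale `M`: an irreducible `P ∈ ℤ[X]` with a root `α`, `D := deg P ≤ m`,
  `M(P) ≤ M` and `|ξ − α| ≤ exp(−0.006 (m log M(P) + D log M))`;
* the clause measure `stub_expAlgIrredClauseMeasure` (Mahler 1932 / Ably 1994 at rank one, LINEAR in the
  degree, p148854): `|α − e^β| ≥ exp(−C · D · log H)` for every height `H ≥ H₀(m)` bounding the coefficients
  of `P`.
With `H := max (H(P), H₀(m))`, `H(P) ≤ 2^D M(P)` (`natHeight_le`) one gets `log H ≤ m log 2 + log M(P) + L`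
(`L := log max(H₀(m), 1)`), so `0.006 (m log M(P) + D log M) ≤ C D log H ≤ C D log M(P) + K` with the
`M`-independent slack `K := C m (m log 2 + L)`.  If `C D < 0.003 m` this forces `0.006 log M ≤ K`, impossible once
`log M ≥ K / 0.006 + 1`; hence `D ≥ 0.003 m / C` and `|ξ − α| ≤ exp(−0.006 D log M) ≤ exp(−q m log M)` with
`q := 18 · 10⁻⁶ / C`.  No named facts are used.
-/

noncomputable section

set_option linter.dupNamespace false -- mandated summit/sub-problem namespace (single-conjunct summit)

namespace Summit.Schanuel.Schanuel.Cruxes.KhovanskiiApproxTypeEv.AnchoredReduction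

open Polynomial
open Summit.Schanuel.Schanuel.Cruxes.KhovanskiiApproxType.Negative
  (natHeight abs_coeff_le_natHeight one_le_natHeight natHeight_le)
open Literature.NumberTheory.DiophantineApproximation (Bugeaud2004_thm_8_11_holds
  one_le_mahlerMeasure_map)
open Literature.NumberTheory.Transcendental.NW1996 (irreducible_map_rat_of_irreducible)

/-- **`stub_syncDiazSlot` — a SYNCHRONISED Diaz slot** (registered sub-goal H of skeleton v14, line `Sketch`;
lead c14).  For algebraic `β ≠ 0` there is `q > 0` such that for every degree budget `m ≥ 50`, at EVERY
sufficiently large scale `M`, some algebraic `α` with an irreducible integer clause `P`, `1 ≤ deg P ≤ m`,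
`M(P) ≤ M`, satisfies `|e^β − α| ≤ exp(−q m log M)`.  Diaz's theorem (`Bugeaud2004_thm_8_11_holds`, PROVED)
supplies `α` with `|e^β − α| ≤ exp(−0.006 (m log M(P) + deg P · log M))`; the linear-in-degree clause measure
of `e^β` (`stub_expAlgIrredClauseMeasure`, PROVED) forces `deg P ≥ 0.003 m / C_β` once `log M` dominates the
`M`-independent slack, whence `q := 18 · 10⁻⁶ / C_β`. [cite: Bugeaud2004, Thm 8.11] -/
theorem stub_syncDiazSlot : ∀ (β : ℂ), IsAlgebraic ℚ β → β ≠ 0 →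
    ∃ q : ℝ, 0 < q ∧ ∀ m : ℕ, 50 ≤ m → ∃ M₀ : ℝ, ∀ M : ℝ, M₀ ≤ M →
      ∃ (α : ℂ) (P : Polynomial ℤ), Irreducible P ∧ Polynomial.aeval α P = 0 ∧
        1 ≤ P.natDegree ∧ P.natDegree ≤ m ∧
        (P.map (Int.castRingHom ℂ)).mahlerMeasure ≤ M ∧
        ‖Complex.exp β - α‖ ≤ Real.exp (-(q * m * Real.log M)) := by
  intro β hβ hβ0
  obtain ⟨C, hC, hmeas⟩ := stub_expAlgIrredClauseMeasure β hβ hβ0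
  refine ⟨18 / 1000000 / C, by positivity, fun m hm50 => ?_⟩
  -- the threshold of the clause measure at degree budget `m`
  obtain ⟨T, hT⟩ := hmeas m
  have hm0 : (0 : ℝ) ≤ m := Nat.cast_nonneg _
  set W : ℝ := max (T : ℝ) 1 with hW
  have hW1 : 1 ≤ W := le_max_right _ _
  have hWpos : 0 < W := by linarith
  have hL0 : 0 ≤ Real.log W := Real.log_nonneg hW1
  have hlog2 : 0 ≤ Real.log 2 := Real.log_nonneg (by norm_num)
  -- the `M`-independent slack and the threshold `M₀`
  set K : ℝ := C * m * (m * Real.log 2 + Real.log W) with hK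
  have hK0 : 0 ≤ K := by rw [hK]; positivity
  refine ⟨max (max ((m : ℝ) + 1) ((4 + ‖Complex.exp β‖) ^ 100)) (Real.exp (K / (6 / 1000) + 1)),
    fun M hM => ?_⟩
  have hM1 : (m : ℝ) + 1 ≤ M := ((le_max_left _ _).trans (le_max_left _ _)).trans hM
  have hM2 : (4 + ‖Complex.exp β‖) ^ 100 ≤ M := ((le_max_right _ _).trans (le_max_left _ _)).trans hM
  have hMpos : 0 < M := by linarith
  have hlogM : K / (6 / 1000) + 1 ≤ Real.log M := by
    rw [Real.le_log_iff_exp_le hMpos]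
    exact (le_max_right _ _).trans hM
  have hKM : K + 6 / 1000 ≤ 6 / 1000 * Real.log M := by
    have h6 : (6 / 1000 : ℝ) * (K / (6 / 1000)) = K := by field_simp
    have h := mul_le_mul_of_nonneg_left hlogM (by norm_num : (0 : ℝ) ≤ 6 / 1000)
    rw [mul_add, h6] at h
    linarith
  have hlM : 0 ≤ Real.log M := by linarith
  -- Diaz / Bugeaud 8.11 at `ξ = e^β`, degree `m`, scale `M`
  obtain ⟨α, P, hPirr, hPα, hPdeg, hPM, hdist⟩ :=
    Bugeaud2004_thm_8_11_holds (Complex.exp β) m M hm50 hM1 hM2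
  have hP0 : P ≠ 0 := hPirr.ne_zero
  have hdP : 1 ≤ P.natDegree := by
    rw [Nat.one_le_iff_ne_zero]
    intro h0
    have hc : P = Polynomial.C (P.coeff 0) := eq_C_of_natDegree_eq_zero h0
    rw [hc, aeval_C, algebraMap_int_eq, eq_intCast, Int.cast_eq_zero] at hPα
    exact hP0 (by rw [hc, hPα, map_zero])
  have hD1 : (1 : ℝ) ≤ P.natDegree := by exact_mod_cast hdP
  have hDm : (P.natDegree : ℝ) ≤ m := by exact_mod_cast hPdeg
  set MP : ℝ := (P.map (Int.castRingHom ℂ)).mahlerMeasure with hMP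
  have hMP1 : 1 ≤ MP := one_le_mahlerMeasure_map P hP0
  have hMPpos : 0 < MP := by linarith
  have hlogMP : 0 ≤ Real.log MP := Real.log_nonneg hMP1
  -- the clause measure at the height `H := max (H(P), T)`
  set H : ℕ := max (natHeight P) T with hHdef
  have hHP : natHeight P ≤ H := le_max_left _ _
  have hTH : T ≤ H := le_max_right _ _
  have hH1 : (1 : ℝ) ≤ H := by exact_mod_cast (one_le_natHeight P hP0).trans hHP
  have hHpos : (0 : ℝ) < H := by linarith
  have hirrQ : Irreducible (P.map (Int.castRingHom ℚ)) :=
    irreducible_map_rat_of_irreducible hPirr (by omega)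
  have key := hT H α P hTH hirrQ hPα hPdeg
    (fun l => (abs_coeff_le_natHeight P l).trans (by exact_mod_cast hHP))
  rw [norm_sub_rev] at key
  -- height bookkeeping: `log H ≤ m log 2 + log M(P) + log W`
  have hlogH : Real.log H ≤ m * Real.log 2 + Real.log MP + Real.log W := by
    have h2m1 : (1 : ℝ) ≤ 2 ^ m * MP :=
      one_le_mul_of_one_le_of_one_le (one_le_pow₀ (by norm_num)) hMP1
    have hHle : (H : ℝ) ≤ 2 ^ m * MP * W := by
      have hcast : (H : ℝ) = max (natHeight P : ℝ) (T : ℝ) := by rw [hHdef, Nat.cast_max]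
      rw [hcast]
      refine max_le ?_ ?_
      · calc (natHeight P : ℝ) ≤ 2 ^ P.natDegree * MP := natHeight_le P
          _ ≤ 2 ^ m * MP :=
            mul_le_mul_of_nonneg_right (pow_le_pow_right₀ (by norm_num) hPdeg) hMPpos.le
          _ ≤ 2 ^ m * MP * W := le_mul_of_one_le_right (by positivity) hW1
      · calc (T : ℝ) ≤ W := le_max_left _ _
          _ ≤ 2 ^ m * MP * W := le_mul_of_one_le_left hWpos.le h2m1
    calc Real.log H ≤ Real.log (2 ^ m * MP * W) := Real.log_le_log hHpos hHle
      _ = m * Real.log 2 + Real.log MP + Real.log W := by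
        rw [Real.log_mul (by positivity) hWpos.ne', Real.log_mul (by positivity) hMPpos.ne',
          Real.log_pow]
  -- `C · deg P · log H ≤ C · deg P · log M(P) + K`
  have hCD0 : 0 ≤ C * P.natDegree := by positivity
  have hbound : C * (P.natDegree : ℝ) * Real.log H ≤ C * P.natDegree * Real.log MP + K := by
    calc C * (P.natDegree : ℝ) * Real.log H
        ≤ C * P.natDegree * (m * Real.log 2 + Real.log MP + Real.log W) :=
          mul_le_mul_of_nonneg_left hlogH hCD0
      _ = C * P.natDegree * Real.log MP + C * P.natDegree * (m * Real.log 2 + Real.log W) := by ring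
      _ ≤ C * P.natDegree * Real.log MP + C * m * (m * Real.log 2 + Real.log W) := by gcongr
      _ = C * P.natDegree * Real.log MP + K := by rw [hK]
  -- the chain `exp(−C D log H) ≤ |ξ − α| ≤ exp(−0.006 (m log M(P) + D log M))`
  have hchain : Real.exp (-(C * (P.natDegree : ℝ) * Real.log H)) ≤
      Real.exp (-(6 / 1000 * ((m : ℝ) * Real.log MP + (P.natDegree : ℝ) * Real.log M))) :=
    key.trans hdist
  rw [Real.exp_le_exp] at hchain
  have hmMP : 0 ≤ (m : ℝ) * Real.log MP := by positivity
  rcases lt_or_ge (C * (P.natDegree : ℝ)) (3 / 1000 * m) with hcase | hcase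
  · -- `C D < 0.003 m`: the measure would force `0.006 log M ≤ K`, contradicting the choice of `M₀`
    exfalso
    have h1 : C * (P.natDegree : ℝ) * Real.log MP ≤ 3 / 1000 * m * Real.log MP :=
      mul_le_mul_of_nonneg_right hcase.le hlogMP
    have h2 : Real.log M ≤ (P.natDegree : ℝ) * Real.log M := le_mul_of_one_le_left hlM hD1
    linarith
  · -- `C D ≥ 0.003 m`: the Diaz quality is at least `0.006 D log M ≥ q m log M`
    refine ⟨α, P, hPirr, hPα, hdP, hPdeg, hPM, hdist.trans ?_⟩
    rw [Real.exp_le_exp]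
    have hq : 18 / 1000000 / C * (m : ℝ) ≤ 6 / 1000 * (P.natDegree : ℝ) := by
      rw [div_mul_eq_mul_div, div_le_iff₀ hC]
      linarith
    have h4 : 18 / 1000000 / C * (m : ℝ) * Real.log M ≤ 6 / 1000 * (P.natDegree : ℝ) * Real.log M :=
      mul_le_mul_of_nonneg_right hq hlM
    linarith

end Summit.Schanuel.Schanuel.Cruxes.KhovanskiiApproxTypeEv.AnchoredReduction

end
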